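import Literature.Barriers.CriticalPhenomena.WeaklySAWRenormalisedParameters
import HarnessLib

/-!
# BBS 2015, eq. (3.19) (constant couplings) and §4.1: the self-normalisation
# `∫ e^{-Σ_x(pτ_{Δ,x} + qτ_x² + rτ_x)} = 1` and `E_C Z₀ = E_C e^{-V₀(Λ)} = 1`

Sequel to `WeaklySAWRenormalisedParameters.lean`. Bauerschmidt–Brydges–Slade, CMP 337 (2015),
arXiv:1403.7422, §3.3, display (3.19): "there is the remarkable self-normalisation property that
`∫ e^{-Σ_{x∈Λ}(p_xτ_{Δ,x} + q_xτ_x² + r_xτ_x)} = 1` for all `p_x ≥ 0`, `q_x > 0`, `r_x ∈ ℝ`, as a result of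
supersymmetry"; and §4.1: "the partition function `E_C Z₀` is equal to `1` by supersymmetry". This file
proves the case of CONSTANT couplings `p, q, r` (which is the one entering §4: `E_C Z₀ = 1`), in the
generality of an arbitrary finite `Λ` and an arbitrary kinetic matrix `A` with `Re φAφ̄ ≥ 0` in place of
`p(-Δ)`:

* §"Analytic": for a `0`-form observable `h` with `|h(φ)| ≤ (1+‖φ‖)²`, the super-integral
  `obsSideC h A g ν = ∫ h e^{-S_A} e^{-Σ(gτ²+ντ)}` is an entire function of `ν` (`topHC`, `topHDerivC`,
  `hasDerivAt_topHC`, `norm_topHC_le_and`, `hasDerivAt_integral_topHC`, `differentiable_obsSideC`) — the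
  argument of `WeaklySAWSupersymmetricRepresentationAnalytic.lean` (there for `h = φ_bφ̄_a`) run for a
  general observable, reusing its envelope;
* §"GaussFourier": **`superIntegral_superGauss_mul_interactionForm_of_pos`**: for `ν > 0`,
  `∫ e^{-S_A}e^{-Σ(gτ²+ντ)} = ∫_{ℝ^Λ}Π_xρ_g(w_x)·(∫e^{-S_{A+ν+iW}})dw = ∫Π_xρ_g(w_x)dw = 1` (the Gauss–Fourier
  representation of `WeaklySAWTauIsomorphism.lean` with observable `1`, Fubini, and the Gaussian
  self-normalisation `∫e^{-S_B} = 1` of `WeaklySAWSuperGaussian.lean`);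
* §"AllNu": **`superIntegral_superGauss_mul_interactionForm_eq_one`** — all real `ν` by the identity
  theorem; **`selfNormalisation_const`** (eq. (3.19) with constant `p ≥ 0`, `q > 0`, `r ∈ ℝ` on the torus,
  `Σ_xτ_{Δ,x} = S_{-Δ}` by eq. (3.11)); **`superExpectation_boltzmannZ0`: `E_C Z₀ = 1`** for
  `C = (-Δ+m²)⁻¹`, `m² > 0`, `g₀ > 0`, `ν₀ ∈ ℝ`, `z₀ > -1`.

Everything is proved; no named facts. The site-dependent case of (3.19) (which the source uses in §5 for
`X ⊂ Λ`) is not treated here.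
-/

noncomputable section

open MeasureTheory Filter Topology Set Complex ComplexConjugate
open scoped ENNReal
open Literature.Probability.LatticeModels
open Literature.MathematicalPhysics.QuantumLattice
open Literature.MathematicalPhysics.QuantumLattice.GrassmannAlgebra (berezin)
open scoped BigOperators

namespace Literature.Barriers.CriticalPhenomena

namespace CTWSAW

/-! ### `∫ h e^{-S_A}e^{-Σ(gτ²+ντ)}` is entire in `ν` for a quadratically bounded observable `h` -/

section Analytic

variable {Λ : Type*} [Fintype Λ] [LinearOrder Λ]

/-- The top coefficient of `h e^{-S_A}e^{-Σ(gτ²+ντ)}` as an explicit function of `(ν, φ)`. [folklore] -/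
def topHC (h : FieldFun Λ) (A : Matrix Λ Λ ℂ) (g : ℝ) (ν : ℂ) (φ : Λ → ℂ) : ℂ :=
  h φ * (Boson.gaussWeight A φ * cexp (-∑ x, interactionScalarC g ν x φ)) * coeffPoly A g ν φ

/-- Its `ν`-derivative. [folklore] -/
def topHDerivC (h : FieldFun Λ) (A : Matrix Λ Λ ℂ) (g : ℝ) (ν : ℂ) (φ : Λ → ℂ) : ℂ :=
  h φ * (Boson.gaussWeight A φ * cexp (-∑ x, interactionScalarC g ν x φ)) *
    (-sumSqC φ * coeffPoly A g ν φ + coeffPolyDeriv A g ν φ)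

/-- **`∫ h e^{-S_A}e^{-Σ(gτ²+ντ)}` for complex `ν`.** [folklore] -/
def obsSideC (h : FieldFun Λ) (A : Matrix Λ Λ ℂ) (g : ℝ) (ν : ℂ) : ℂ :=
  superIntegral (ofFun h * (superGauss A * interactionFormC g ν))

/-- `obsSideC = ε π^{-|Λ|} ∫ topHC dφ`. [folklore] -/
theorem obsSideC_eq_integral (h : FieldFun Λ) (A : Matrix Λ Λ ℂ) (g : ℝ) (ν : ℂ) :
    obsSideC h A g ν = orientSign Λ * ((Real.pi : ℂ)⁻¹) ^ Fintype.card Λ * ∫ φ, topHC h A g ν φ := by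
  rw [obsSideC, superIntegral]
  congr 1
  refine integral_congr_ae (Eventually.of_forall fun φ => ?_)
  rw [berezin_ofFun_mul_superGauss_mul_interactionFormC_apply]
  rfl

/-- `topHC` is entire in `ν` with derivative `topHDerivC`. [folklore] -/
theorem hasDerivAt_topHC (h : FieldFun Λ) (A : Matrix Λ Λ ℂ) (g : ℝ) (φ : Λ → ℂ) (ν : ℂ) :
    HasDerivAt (fun ν => topHC h A g ν φ) (topHDerivC h A g ν φ) ν := by
  set C₀ : ℂ := -((g : ℂ) * ∑ x, (((‖φ x‖ ^ 4 : ℝ)) : ℂ)) with hC₀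
  have hfun : (fun ν : ℂ => cexp (-∑ x, interactionScalarC g ν x φ)) =
      fun ν => cexp (C₀ - ν * sumSqC φ) := by
    funext ν; rw [neg_sum_interactionScalarC_eq]
  have hE : HasDerivAt (fun ν : ℂ => cexp (-∑ x, interactionScalarC g ν x φ))
      (cexp (-∑ x, interactionScalarC g ν x φ) * -sumSqC φ) ν := by
    rw [hfun, neg_sum_interactionScalarC_eq]
    have h0 : HasDerivAt (fun ν : ℂ => C₀ - ν * sumSqC φ) (0 - 1 * sumSqC φ) ν :=
      (hasDerivAt_const ν C₀).sub ((hasDerivAt_id ν).mul_const (sumSqC φ))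
    refine h0.cexp.congr_deriv ?_
    ring
  have hb : ∀ x, HasDerivAt (fun ν : ℂ => interactionCoeffC g ν x φ) 1 ν := fun x =>
    (hasDerivAt_id ν).const_add (2 * (g : ℂ) * (((‖φ x‖ ^ 2 : ℝ)) : ℂ))
  have hP : HasDerivAt (fun ν : ℂ => coeffPoly A g ν φ) (coeffPolyDeriv A g ν φ) ν := by
    unfold coeffPoly coeffPolyDeriv
    refine HasDerivAt.fun_sum fun S _ => ?_
    have hprod := HasDerivAt.finsetProd (u := S) (f := fun x (ν : ℂ) => interactionCoeffC g ν x φ)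
      (f' := fun _ => (1 : ℂ)) (x := ν) fun x _ => hb x
    simp only [smul_eq_mul, mul_one] at hprod
    have hprod' : HasDerivAt (fun ν : ℂ => ∏ x ∈ S, interactionCoeffC g ν x φ)
        (∑ y ∈ S, ∏ x ∈ S.erase y, interactionCoeffC g ν x φ) ν := by
      refine hprod.congr_of_eventuallyEq (Eventually.of_forall fun ν' => ?_)
      simp [Finset.prod_apply]
    exact hprod'.mul_const _
  have hd := ((hE.const_mul (Boson.gaussWeight A φ)).const_mul (h φ)).mul hP
  refine hd.congr_deriv ?_
  simp only [topHDerivC]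
  ring

variable {A : Matrix Λ Λ ℂ} {g R : ℝ} {ν : ℂ} {h : FieldFun Λ}

variable [Nonempty Λ]

/-- **Domination of `topHC` and `∂_ν topHC` by the envelope** (`|h(φ)| ≤ (1+‖φ‖)²`, `‖ν‖ ≤ R`, `R ≥ 0`,
`g > 0`, `Re φAφ̄ ≥ 0`). [folklore] -/
theorem norm_topHC_le_and (hA : ∀ φ, 0 ≤ (Boson.quadForm A φ).re) (hg : 0 < g) (hR : 0 ≤ R)
    (hν : ‖ν‖ ≤ R) (hh : ∀ φ, ‖h φ‖ ≤ (1 + ‖φ‖) ^ 2) (φ : Λ → ℂ) :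
    ‖topHC h A g ν φ‖ ≤ envelope A g R φ ∧ ‖topHDerivC h A g ν φ‖ ≤ envelope A g R φ := by
  set M : ℕ := Fintype.card Λ with hM
  set u : ℝ := 1 + ‖φ‖ with hu
  have hu1 : 1 ≤ u := by rw [hu]; linarith [norm_nonneg φ]
  have hu0 : 0 ≤ u := by linarith
  have h_obs : ‖h φ‖ ≤ u ^ 2 := hh φ
  have h_gw : ‖Boson.gaussWeight A φ‖ ≤ 1 := by
    rw [Boson.norm_gaussWeight]; exact Real.exp_le_one_iff.2 (by linarith [hA φ])
  have h_exp : ‖cexp (-∑ x, interactionScalarC g ν x φ)‖ ≤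
      Real.exp (M * (R + 1) ^ 2 / (4 * g)) * Real.exp (-(1 * ‖φ‖ ^ 2)) := by
    rw [Complex.norm_exp, ← Real.exp_add]
    refine Real.exp_le_exp.2 ?_
    have := re_neg_sum_interactionScalarC_le hg hν φ
    rw [← hM] at this; linarith
  have h_site : siteEnvelope g R φ ≤ (1 + 2 * g + R) ^ M * u ^ (2 * M) := by
    refine (siteEnvelope_le hg.le hR φ).trans (le_of_eq ?_)
    rw [mul_pow, ← pow_mul, hu, hM]
  have hCμ := momentConst_nonneg' A
  have h_P : ‖coeffPoly A g ν φ‖ ≤ momentConst A * ((1 + 2 * g + R) ^ M * u ^ (2 * M)) :=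
    (norm_coeffPoly_le hg.le hR hν φ).trans (mul_le_mul_of_nonneg_left h_site hCμ)
  have h_P' : ‖coeffPolyDeriv A g ν φ‖ ≤ momentConst A * (M * ((1 + 2 * g + R) ^ M * u ^ (2 * M))) :=
    (norm_coeffPolyDeriv_le hg.le hR hν φ).trans
      (mul_le_mul_of_nonneg_left (mul_le_mul_of_nonneg_left h_site (Nat.cast_nonneg _)) hCμ)
  have h_s : ‖sumSqC φ‖ ≤ M * u ^ 2 := norm_sumSqC_le φ
  set B : ℝ := (1 + 2 * g + R) ^ M * u ^ (2 * M) with hB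
  have hB0 : 0 ≤ B := by positivity
  set E : ℝ := Real.exp (M * (R + 1) ^ 2 / (4 * g)) * Real.exp (-(1 * ‖φ‖ ^ 2)) with hE
  have hE0 : 0 ≤ E := by positivity
  have henv : envelope A g R φ = momentConst A * (2 * M + 1) * (1 + 2 * g + R) ^ M *
      Real.exp (M * (R + 1) ^ 2 / (4 * g)) * (u ^ (2 * M + 4) * Real.exp (-(1 * ‖φ‖ ^ 2))) := by
    simp only [envelope, hM, hu]
  have hcore : u ^ 2 * E * (momentConst A * ((2 * M + 1) * u ^ 2 * B)) = envelope A g R φ := by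
    rw [henv, hB, hE]; ring
  have hpow : u ^ 2 * E * (momentConst A * B) ≤ envelope A g R φ := by
    rw [← hcore]
    refine mul_le_mul_of_nonneg_left (mul_le_mul_of_nonneg_left ?_ hCμ) (mul_nonneg (by positivity) hE0)
    have hM1 : (1 : ℝ) ≤ 2 * (M : ℝ) + 1 := by
      have := (Nat.cast_nonneg M : (0 : ℝ) ≤ M); linarith
    have hu2 : (1 : ℝ) ≤ u ^ 2 := by nlinarith [hu1]
    have : (1 : ℝ) * 1 * B ≤ (2 * M + 1) * u ^ 2 * B := by
      refine mul_le_mul_of_nonneg_right ?_ hB0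
      exact mul_le_mul hM1 hu2 zero_le_one (by positivity)
    linarith
  constructor
  · have htop : topHC h A g ν φ = h φ *
        (Boson.gaussWeight A φ * cexp (-∑ x, interactionScalarC g ν x φ)) * coeffPoly A g ν φ := rfl
    rw [htop]
    simp only [norm_mul]
    calc ‖h φ‖ * (‖Boson.gaussWeight A φ‖ * ‖cexp (-∑ x, interactionScalarC g ν x φ)‖) * ‖coeffPoly A g ν φ‖
        ≤ u ^ 2 * (1 * E) * (momentConst A * B) := by
          refine mul_le_mul (mul_le_mul h_obs (mul_le_mul h_gw h_exp (norm_nonneg _) zero_le_one)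
            (by positivity) (by positivity)) h_P (norm_nonneg _) (by positivity)
      _ = u ^ 2 * E * (momentConst A * B) := by ring
      _ ≤ envelope A g R φ := hpow
  · unfold topHDerivC
    simp only [norm_mul]
    have hlast : ‖-sumSqC φ * coeffPoly A g ν φ + coeffPolyDeriv A g ν φ‖ ≤
        momentConst A * ((2 * M + 1) * u ^ 2 * B) := by
      refine (norm_add_le _ _).trans ?_
      rw [norm_mul, norm_neg]
      have h1 : ‖sumSqC φ‖ * ‖coeffPoly A g ν φ‖ ≤ M * u ^ 2 * (momentConst A * B) :=
        mul_le_mul h_s h_P (norm_nonneg _) (by positivity)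
      have h2 : (M : ℝ) * B ≤ (M + 1) * u ^ 2 * B := by
        refine mul_le_mul_of_nonneg_right ?_ hB0
        nlinarith [hu1, (Nat.cast_nonneg M : (0 : ℝ) ≤ M)]
      calc ‖sumSqC φ‖ * ‖coeffPoly A g ν φ‖ + ‖coeffPolyDeriv A g ν φ‖
          ≤ M * u ^ 2 * (momentConst A * B) + momentConst A * (M * B) := add_le_add h1 h_P'
        _ ≤ M * u ^ 2 * (momentConst A * B) + momentConst A * ((M + 1) * u ^ 2 * B) := by
            linarith [mul_le_mul_of_nonneg_left h2 hCμ]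
        _ = momentConst A * ((2 * M + 1) * u ^ 2 * B) := by ring
    calc ‖h φ‖ * (‖Boson.gaussWeight A φ‖ * ‖cexp (-∑ x, interactionScalarC g ν x φ)‖) *
          ‖-sumSqC φ * coeffPoly A g ν φ + coeffPolyDeriv A g ν φ‖
        ≤ u ^ 2 * (1 * E) * (momentConst A * ((2 * M + 1) * u ^ 2 * B)) := by
          refine mul_le_mul (mul_le_mul h_obs (mul_le_mul h_gw h_exp (norm_nonneg _) zero_le_one)
            (by positivity) (by positivity)) hlast (norm_nonneg _) (by positivity)
      _ = envelope A g R φ := by rw [← hcore]; ring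

omit [Nonempty Λ] in
/-- `φ ↦ topHC(ν, φ)` is continuous for continuous `h`. [folklore] -/
theorem continuous_topHC (hh : Continuous h) (A : Matrix Λ Λ ℂ) (g : ℝ) (ν : ℂ) :
    Continuous fun φ : Λ → ℂ => topHC h A g ν φ := by
  have h2 : Continuous fun φ : Λ → ℂ => Boson.gaussWeight A φ * cexp (-∑ x, interactionScalarC g ν x φ) := by
    unfold Boson.gaussWeight Boson.quadForm interactionScalarC; fun_prop
  have h3 : Continuous fun φ : Λ → ℂ => coeffPoly A g ν φ := by
    unfold coeffPoly interactionCoeffC; fun_prop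
  exact (hh.mul h2).mul h3

omit [Nonempty Λ] in
/-- `φ ↦ ∂_ν topHC(ν, φ)` is continuous for continuous `h`. [folklore] -/
theorem continuous_topHDerivC (hh : Continuous h) (A : Matrix Λ Λ ℂ) (g : ℝ) (ν : ℂ) :
    Continuous fun φ : Λ → ℂ => topHDerivC h A g ν φ := by
  have h2 : Continuous fun φ : Λ → ℂ => Boson.gaussWeight A φ * cexp (-∑ x, interactionScalarC g ν x φ) := by
    unfold Boson.gaussWeight Boson.quadForm interactionScalarC; fun_prop
  have h3 : Continuous fun φ : Λ → ℂ => -sumSqC φ * coeffPoly A g ν φ + coeffPolyDeriv A g ν φ := by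
    unfold coeffPoly coeffPolyDeriv sumSqC interactionCoeffC; fun_prop
  exact (hh.mul h2).mul h3

/-- The top coefficient `topHC(ν, ·)` is integrable. [folklore] -/
theorem integrable_topHC (hA : ∀ φ, 0 ≤ (Boson.quadForm A φ).re) (hg : 0 < g) (hh : Continuous h)
    (hhb : ∀ φ, ‖h φ‖ ≤ (1 + ‖φ‖) ^ 2) (ν : ℂ) :
    Integrable fun φ => topHC h A g ν φ :=
  (integrable_envelope A g ‖ν‖).mono' (continuous_topHC hh A g ν).aestronglyMeasurable
    (Eventually.of_forall fun φ => (norm_topHC_le_and hA hg (norm_nonneg ν) le_rfl hhb φ).1)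

/-- Differentiation under the `φ`-integral. [folklore] -/
theorem hasDerivAt_integral_topHC (hA : ∀ φ, 0 ≤ (Boson.quadForm A φ).re) (hg : 0 < g) (hh : Continuous h)
    (hhb : ∀ φ, ‖h φ‖ ≤ (1 + ‖φ‖) ^ 2) (ν₀ : ℂ) :
    HasDerivAt (fun ν => ∫ φ, topHC h A g ν φ) (∫ φ, topHDerivC h A g ν₀ φ) ν₀ := by
  set R : ℝ := ‖ν₀‖ + 1 with hRdef
  have hR : 0 ≤ R := by positivity
  have hball : ∀ ν ∈ Metric.ball ν₀ 1, ‖ν‖ ≤ R := fun ν hν => by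
    have := Metric.mem_ball.1 hν
    calc ‖ν‖ = ‖ν₀ + (ν - ν₀)‖ := by ring_nf
      _ ≤ ‖ν₀‖ + ‖ν - ν₀‖ := norm_add_le _ _
      _ ≤ ‖ν₀‖ + 1 := by rw [← dist_eq_norm]; linarith
  have hν₀ : ‖ν₀‖ ≤ R := by rw [hRdef]; linarith
  refine (hasDerivAt_integral_of_dominated_loc_of_deriv_le (μ := volume) (x₀ := ν₀)
    (s := Metric.ball ν₀ 1) (F := fun ν φ => topHC h A g ν φ) (F' := fun ν φ => topHDerivC h A g ν φ)
    (bound := envelope A g R) (Metric.ball_mem_nhds ν₀ one_pos)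
    (Eventually.of_forall fun ν => (continuous_topHC hh A g ν).aestronglyMeasurable) ?_
    (continuous_topHDerivC hh A g ν₀).aestronglyMeasurable ?_ (integrable_envelope A g R) ?_).2
  · exact (integrable_envelope A g R).mono' (continuous_topHC hh A g ν₀).aestronglyMeasurable
      (Eventually.of_forall fun φ => (norm_topHC_le_and hA hg hR hν₀ hhb φ).1)
  · exact Eventually.of_forall fun φ ν hν => (norm_topHC_le_and hA hg hR (hball ν hν) hhb φ).2
  · exact Eventually.of_forall fun φ ν _ => hasDerivAt_topHC h A g φ ν

/-- **`ν ↦ ∫ h e^{-S_A}e^{-Σ(gτ²+ντ)}` is entire** (`g > 0`, `Re φAφ̄ ≥ 0`, `h` continuous with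
`|h(φ)| ≤ (1+‖φ‖)²`). [cite: BauerschmidtBrydgesSlade2015LogCorr, Proposition 3.1 (proof: "both sides are analytic in ν")] -/
theorem differentiable_obsSideC (hA : ∀ φ, 0 ≤ (Boson.quadForm A φ).re) (hg : 0 < g) (hh : Continuous h)
    (hhb : ∀ φ, ‖h φ‖ ≤ (1 + ‖φ‖) ^ 2) :
    Differentiable ℂ fun ν => obsSideC h A g ν := by
  have he : (fun ν => obsSideC h A g ν) = fun ν =>
      orientSign Λ * ((Real.pi : ℂ)⁻¹) ^ Fintype.card Λ * ∫ φ, topHC h A g ν φ :=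
    funext fun ν => obsSideC_eq_integral h A g ν
  rw [he]
  exact (differentiable_const _).mul fun ν => (hasDerivAt_integral_topHC hA hg hh hhb ν).differentiableAt

/-- The same, as analyticity on `ℂ`. [folklore] -/
theorem analyticOnNhd_obsSideC (hA : ∀ φ, 0 ≤ (Boson.quadForm A φ).re) (hg : 0 < g) (hh : Continuous h)
    (hhb : ∀ φ, ‖h φ‖ ≤ (1 + ‖φ‖) ^ 2) :
    AnalyticOnNhd ℂ (fun ν => obsSideC h A g ν) univ :=
  (differentiable_obsSideC hA hg hh hhb).differentiableOn.analyticOnNhd isOpen_univ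

end Analytic

/-! ### `ν > 0`: `∫ e^{-S_A}e^{-Σ(gτ²+ντ)} = ∫ Π_xρ_g(w_x)·(∫ e^{-S_{A+ν+iW}}) dw = 1` -/

section GaussFourier

variable {Λ : Type*} [Fintype Λ] [LinearOrder Λ] {A : Matrix Λ Λ ℂ} {g ν : ℝ}

omit [LinearOrder Λ] in
/-- `∫_{ℝ^Λ} Π_x ρ_g(w_x) dw = 1` (complex-valued). [folklore] -/
theorem integral_prod_gaussDensity_eq_one (hg : 0 < g) :
    ∫ w : Λ → ℝ, ∏ x, (gaussDensity g (w x) : ℂ) = 1 := by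
  rw [volume_pi, integral_fintype_prod_eq_prod (𝕜 := ℂ) (f := fun (_ : Λ) (t : ℝ) => (gaussDensity g t : ℂ))]
  simp [integral_gaussDensity_complex hg]

/-- **`∫ e^{-S_A}e^{-Σ_x(gτ_x²+ντ_x)} = 1` for `ν > 0`** (`g > 0`, `Re φAφ̄ ≥ 0`): the Gauss–Fourier
representation with observable `1`, Fubini, and `∫ e^{-S_{A+ν+iW}} = 1` for every `w`
(`superIntegral_superGauss`), then `∫Π_xρ_g(w_x)dw = 1`. [cite: BauerschmidtBrydgesSlade2015LogCorr, §3.3, eq. (3.19) (self-normalisation "as a result of supersymmetry")]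
[cite: BrydgesImbrieSlade2009, Proposition 4.4, eq. (F0) (∫e^{-S_A}F(τ) = F(0))] -/
theorem superIntegral_superGauss_mul_interactionForm_of_pos (hA : ∀ φ, 0 ≤ (Boson.quadForm A φ).re)
    (hg : 0 < g) (hν : 0 < ν) :
    superIntegral (superGauss A * interactionForm g ν) = 1 := by
  classical
  set μS : Finset Λ → ℂ := fun S => orientSign Λ * (rowUnitMatrix A.transpose S).det with hμS
  set T : (Λ → ℂ) → (Λ → ℝ) → ℂ := fun φ w => (∏ x, (gaussDensity g (w x) : ℂ)) *
    berezin (FieldFun Λ) (Λ ⊕ₗ Λ) (ofFun 1 * superGauss (A + Matrix.diagonal fun x => (ν : ℂ) + I * w x)) φ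
    with hT
  have hTexpl : ∀ φ w, T φ w = (∏ x, (gaussDensity g (w x) : ℂ)) *
      ((1 : FieldFun Λ) φ * (Boson.gaussWeight A φ * cexp (-∑ x, ((ν : ℂ) + I * w x) * (((‖φ x‖ ^ 2 : ℝ)) : ℂ))) *
        ∑ S : Finset Λ, (∏ x ∈ S, ((ν : ℂ) + I * w x)) * μS S) := by
    intro φ w; rw [hT, hμS]; simp only; rw [berezin_ofFun_mul_superGauss_add_diagonal_apply]
  -- Step 1: LHS as an iterated integral
  have h1 : superIntegral (superGauss A * interactionForm g ν) =
      orientSign Λ * ((Real.pi : ℂ)⁻¹) ^ Fintype.card Λ * ∫ φ : Λ → ℂ, ∫ w : Λ → ℝ, T φ w := by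
    rw [superIntegral, ← one_mul (superGauss A * interactionForm g ν), ← ofFun_one]
    congr 1
    exact integral_congr_ae (Eventually.of_forall fun φ => berezin_interaction_eq_integral hg ν 1 A φ)
  -- Step 2: joint integrability
  set Cμ : ℝ := ∑ S : Finset Λ, ‖μS S‖ with hCμ
  set gφ : (Λ → ℂ) → ℝ := fun φ => Cμ * (1 * Real.exp (-(ν * ∑ x, ‖φ x‖ ^ 2))) with hgφ
  set fw : (Λ → ℝ) → ℝ := fun w => ∏ x, gaussDensity g (w x) * (1 + (|ν| + |w x|)) with hfw
  have hgφ_int : Integrable gφ := by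
    have hB := re_quadForm_diagonal_const (Λ := Λ) ν
    have h0 := (Boson.integrable_mul_gaussWeight hν hB (F := fun _ => (1 : ℂ)) (by fun_prop) (M := 1) (k := 0)
      fun φ => by simp).norm.const_mul Cμ
    refine h0.congr (Eventually.of_forall fun φ => ?_)
    simp only [hgφ, norm_mul, norm_one, norm_gaussWeight_diagonal_const]
  have hfw_int : Integrable fw := by
    have := Integrable.fintype_prod (𝕜 := ℝ) (μ := fun _ : Λ => (volume : Measure ℝ))
      (f := fun (_ : Λ) (t : ℝ) => gaussDensity g t * (1 + (|ν| + |t|))) fun _ => ?_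
    · rw [← volume_pi] at this; exact this
    · have h1 := (integrable_gaussDensity hg).const_mul (1 + |ν|)
      have h2 := integrable_abs_mul_gaussDensity hg
      refine (h1.add h2).congr (Eventually.of_forall fun t => ?_)
      simp only [Pi.add_apply]; ring
  have hTint : Integrable (Function.uncurry T) ((volume : Measure (Λ → ℂ)).prod volume) := by
    have hB := hgφ_int.mul_prod hfw_int
    refine hB.mono' ?_ (Eventually.of_forall fun p => ?_)
    · have hcont : Continuous (Function.uncurry T) := by
        have : Function.uncurry T = fun p : (Λ → ℂ) × (Λ → ℝ) => (∏ x, (gaussDensity g (p.2 x) : ℂ)) *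
            ((1 : FieldFun Λ) p.1 * (Boson.gaussWeight A p.1 * cexp (-∑ x, ((ν : ℂ) + I * p.2 x) *
              (((‖p.1 x‖ ^ 2 : ℝ)) : ℂ))) * ∑ S : Finset Λ, (∏ x ∈ S, ((ν : ℂ) + I * p.2 x)) * μS S) := by
          funext p; exact hTexpl p.1 p.2
        rw [this]
        refine Continuous.mul ?_ (Continuous.mul (Continuous.mul ?_ (Continuous.mul ?_ ?_)) ?_)
        · exact continuous_finsetProd _ fun x _ => Complex.continuous_ofReal.comp
            ((continuous_gaussDensity g).comp ((continuous_apply x).comp continuous_snd))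
        · exact continuous_const
        · unfold Boson.gaussWeight Boson.quadForm; fun_prop
        · refine Complex.continuous_exp.comp (Continuous.neg (continuous_finsetSum _ fun x _ => ?_))
          fun_prop
        · refine continuous_finsetSum _ fun S _ => Continuous.mul ?_ continuous_const
          exact continuous_finsetProd _ fun x _ => by fun_prop
      exact hcont.aestronglyMeasurable
    · rcases p with ⟨φ, w⟩
      simp only [Function.uncurry_apply_pair]
      rw [hTexpl]
      have hρ : ‖∏ x, (gaussDensity g (w x) : ℂ)‖ = ∏ x, gaussDensity g (w x) := by
        rw [norm_prod]; exact Finset.prod_congr rfl fun x _ => by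
          rw [Complex.norm_real, Real.norm_eq_abs, abs_of_pos (gaussDensity_pos hg _)]
      have hgw : ‖Boson.gaussWeight A φ‖ ≤ 1 := by
        rw [Boson.norm_gaussWeight]; exact Real.exp_le_one_iff.2 (by linarith [hA φ])
      have hexp : ‖cexp (-∑ x, ((ν : ℂ) + I * w x) * (((‖φ x‖ ^ 2 : ℝ)) : ℂ))‖ =
          Real.exp (-(ν * ∑ x, ‖φ x‖ ^ 2)) := by
        rw [Complex.norm_exp]; congr 1
        rw [Complex.neg_re, Complex.re_sum, Finset.mul_sum]; congr 1
        refine Finset.sum_congr rfl fun x _ => ?_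
        rw [Complex.mul_re, Complex.ofReal_re, Complex.ofReal_im, mul_zero, sub_zero]
        simp [Complex.add_re]
      have hlin : ∀ x, ‖(ν : ℂ) + I * w x‖ ≤ |ν| + |w x| := fun x =>
        calc ‖(ν : ℂ) + I * w x‖ ≤ ‖(ν : ℂ)‖ + ‖I * (w x : ℂ)‖ := norm_add_le _ _
          _ = |ν| + |w x| := by rw [norm_mul, Complex.norm_I, one_mul, Complex.norm_real,
              Complex.norm_real, Real.norm_eq_abs, Real.norm_eq_abs]
      have hterm : ∀ S : Finset Λ, ‖∏ x ∈ S, ((ν : ℂ) + I * w x)‖ ≤ ∏ x, (1 + (|ν| + |w x|)) :=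
        fun S =>
        calc ‖∏ x ∈ S, ((ν : ℂ) + I * w x)‖ = ∏ x ∈ S, ‖(ν : ℂ) + I * w x‖ := norm_prod _ _
          _ ≤ ∏ x ∈ S, (|ν| + |w x|) := Finset.prod_le_prod (fun x _ => norm_nonneg _) fun x _ => hlin x
          _ ≤ ∏ x, (1 + (|ν| + |w x|)) :=
              prod_le_prod_one_add (f := fun x => |ν| + |w x|) (fun x => by positivity) S
      have hsum : ‖∑ S : Finset Λ, (∏ x ∈ S, ((ν : ℂ) + I * w x)) * μS S‖ ≤
          Cμ * ∏ x, (1 + (|ν| + |w x|)) := by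
        refine (norm_sum_le _ _).trans ?_
        rw [hCμ, Finset.sum_mul]
        refine Finset.sum_le_sum fun S _ => ?_
        rw [norm_mul, mul_comm]
        exact mul_le_mul_of_nonneg_left (hterm S) (norm_nonneg _)
      have hhn : ‖(1 : FieldFun Λ) φ‖ = 1 := by simp
      simp only [norm_mul, hρ, hhn, hexp]
      have hnn1 : 0 ≤ ∏ x, gaussDensity g (w x) := Finset.prod_nonneg fun x _ => (gaussDensity_pos hg _).le
      calc (∏ x, gaussDensity g (w x)) * (1 * (‖Boson.gaussWeight A φ‖ *
            Real.exp (-(ν * ∑ x, ‖φ x‖ ^ 2))) * ‖∑ S : Finset Λ, (∏ x ∈ S, ((ν : ℂ) + I * w x)) * μS S‖)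
          ≤ (∏ x, gaussDensity g (w x)) * (1 * (1 * Real.exp (-(ν * ∑ x, ‖φ x‖ ^ 2))) *
            (Cμ * ∏ x, (1 + (|ν| + |w x|)))) := by
            gcongr
      _ = gφ φ * fw w := by
            simp only [hgφ, hfw, Finset.prod_mul_distrib]; ring
  -- Step 3: swap and evaluate the `φ`-integral for each `w`
  rw [h1, integral_integral_swap hTint]
  have h3 : ∀ w : Λ → ℝ, ∫ φ : Λ → ℂ, T φ w = (∏ x, (gaussDensity g (w x) : ℂ)) *
      ∫ φ : Λ → ℂ, berezin (FieldFun Λ) (Λ ⊕ₗ Λ)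
        (ofFun 1 * superGauss (A + Matrix.diagonal fun x => (ν : ℂ) + I * w x)) φ := fun w => by
    rw [hT]; exact integral_const_mul _ _
  simp_rw [h3]
  have h4 : ∀ w : Λ → ℝ, orientSign Λ * ((Real.pi : ℂ)⁻¹) ^ Fintype.card Λ *
      ∫ φ : Λ → ℂ, berezin (FieldFun Λ) (Λ ⊕ₗ Λ)
        (ofFun 1 * superGauss (A + Matrix.diagonal fun x => (ν : ℂ) + I * w x)) φ = 1 := by
    intro w
    have hsI := superIntegral_superGauss hν (re_quadForm_add_diagonal_ge hA ν w)
    rwa [superIntegral, ← one_mul (superGauss _), ← ofFun_one] at hsI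
  rw [← integral_const_mul]
  have h5 : ∀ w : Λ → ℝ, orientSign Λ * ((Real.pi : ℂ)⁻¹) ^ Fintype.card Λ *
      ((∏ x, (gaussDensity g (w x) : ℂ)) * ∫ φ : Λ → ℂ, berezin (FieldFun Λ) (Λ ⊕ₗ Λ)
        (ofFun 1 * superGauss (A + Matrix.diagonal fun x => (ν : ℂ) + I * w x)) φ) =
      ∏ x, (gaussDensity g (w x) : ℂ) := by
    intro w
    calc orientSign Λ * ((Real.pi : ℂ)⁻¹) ^ Fintype.card Λ *
        ((∏ x, (gaussDensity g (w x) : ℂ)) * ∫ φ : Λ → ℂ, berezin (FieldFun Λ) (Λ ⊕ₗ Λ)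
          (ofFun 1 * superGauss (A + Matrix.diagonal fun x => (ν : ℂ) + I * w x)) φ)
        = (∏ x, (gaussDensity g (w x) : ℂ)) * (orientSign Λ * ((Real.pi : ℂ)⁻¹) ^ Fintype.card Λ *
          ∫ φ : Λ → ℂ, berezin (FieldFun Λ) (Λ ⊕ₗ Λ)
            (ofFun 1 * superGauss (A + Matrix.diagonal fun x => (ν : ℂ) + I * w x)) φ) := by ring
      _ = ∏ x, (gaussDensity g (w x) : ℂ) := by rw [h4, mul_one]
  simp_rw [h5]
  exact integral_prod_gaussDensity_eq_one hg

end GaussFourier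

/-! ### All real `ν`; eq. (3.19) with constant couplings; `E_C Z₀ = 1` -/

section AllNu

variable {Λ : Type*} [Fintype Λ] [LinearOrder Λ] [Nonempty Λ] {A : Matrix Λ Λ ℂ} {g : ℝ}

/-- **`∫ e^{-S_A} e^{-Σ_x(gτ_x²+ντ_x)} = 1` for EVERY real `ν`** (`g > 0`, `Re φAφ̄ ≥ 0`): both sides are
entire in `ν` and agree for `ν > 0`. [cite: BauerschmidtBrydgesSlade2015LogCorr, §3.3, eq. (3.19)] -/
theorem superIntegral_superGauss_mul_interactionForm_eq_one (hA : ∀ φ, 0 ≤ (Boson.quadForm A φ).re)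
    (hg : 0 < g) (ν : ℝ) :
    superIntegral (superGauss A * interactionForm g ν) = 1 := by
  have hh : Continuous (1 : FieldFun Λ) := continuous_const
  have hhb : ∀ φ : Λ → ℂ, ‖(1 : FieldFun Λ) φ‖ ≤ (1 + ‖φ‖) ^ 2 := fun φ => by
    simp only [Pi.one_apply, norm_one]; nlinarith [norm_nonneg φ]
  have key := entire_eq_of_eqOn_pos (f := fun ν => obsSideC 1 A g ν) (h := fun _ => (1 : ℂ))
    (analyticOnNhd_obsSideC hA hg hh hhb) analyticOnNhd_const (fun t ht => ?_) (ν : ℂ)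
  · rwa [obsSideC, interactionFormC_ofReal, ofFun_one, one_mul] at key
  · show obsSideC 1 A g (t : ℂ) = 1
    rw [obsSideC, interactionFormC_ofReal, ofFun_one, one_mul]
    exact superIntegral_superGauss_mul_interactionForm_of_pos hA hg ht

variable {d n : ℕ} [NeZero n]

attribute [-instance] Fintype.decidablePiFintype

/-- **BBS 2015, eq. (3.19) for constant couplings**: on the torus, for `p ≥ 0`, `q > 0`, `r ∈ ℝ`,
`∫ e^{-Σ_x(pτ_{Δ,x} + qτ_x² + rτ_x)} = 1`, with `Σ_x pτ_{Δ,x} = S_{p(-Δ)}` (eq. (3.11), `sum_tauDelta`) so that the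
integrand is `superGauss (p(-Δ)) · interactionForm q r`. [cite: BauerschmidtBrydgesSlade2015LogCorr, §3.3, eq. (3.19)] -/
theorem selfNormalisation_const {p q : ℝ} (hp : 0 ≤ p) (hq : 0 < q) (r : ℝ) :
    superIntegral (superGauss ((p : ℂ) • negLaplacianC d n) * interactionForm q r) = 1 :=
  superIntegral_superGauss_mul_interactionForm_eq_one (re_quadForm_smul_nonneg re_quadForm_negLaplacianC_nonneg hp)
    hq r

/-- **`E_C Z₀ = E_C e^{-V₀(Λ)} = 1`**: "the partition function `E_C Z₀` is equal to `1` by supersymmetry"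
(`C = (-Δ+m²)⁻¹`, `m² > 0`, `g₀ > 0`, `ν₀ ∈ ℝ`, `z₀ > -1`).
[cite: BauerschmidtBrydgesSlade2015LogCorr, §4.1 ("As mentioned already in (3.19), the partition function E_C Z₀ is equal to 1 by supersymmetry")] -/
theorem superExpectation_boltzmannZ0 {m2 g₀ : ℝ} (hm : 0 < m2) (hg₀ : 0 < g₀) (ν₀ : ℝ) {z₀ : ℝ}
    (hz : -1 < z₀) :
    superExpectation (freeCovariance d n m2) (boltzmannZ0 g₀ ν₀ z₀) = 1 := by
  have hs : 0 ≤ 1 + z₀ := by linarith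
  rw [superExpectation_freeCovariance hm, boltzmannZ0, ← mul_assoc, massLaplacianC, superGauss_mul_superGauss,
    show negLaplacianC d n + Matrix.diagonal (fun _ => (m2 : ℂ)) + (z₀ : ℂ) • negLaplacianC d n =
      (((1 + z₀ : ℝ)) : ℂ) • negLaplacianC d n + Matrix.diagonal (fun _ => (m2 : ℂ)) by
        push_cast; rw [add_smul, one_smul]; abel,
    superGauss_add_diagonal_mul_interactionForm]
  exact superIntegral_superGauss_mul_interactionForm_eq_one
    (re_quadForm_smul_nonneg re_quadForm_negLaplacianC_nonneg hs) hg₀ _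

end AllNu

end CTWSAW

end Literature.Barriers.CriticalPhenomena
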